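import Literature.NumberTheory.Rogawski1990.ArchExplicitTransferFactorCentralCurveRelabel     -- ★ G4a (F0P3a-p05 (g11)): matching, `P_w`, `κ_w`, `Δ″_ρ = τ·K_D(2−2cos)·K_κ(ρ)`, `‖Δ″_ρ‖ ≤ K_D c²ψ²`
import HarnessLib

/-!
# Rogawski's explicit archimedean factor along the central curve — relabelled partners, the `ψ`-DERIVATIVE: `‖∂Δ″_ρ‖ ≤ C|ψ|`, `∂(Δ″_ρ·F) → 0`
# (Rogawski 1990 §14.5 Lemma 14.5.2 (c) p. 238)

Topic `NumberTheory/Rogawski1990`; namespace `Literature.NumberTheory.Rogawski1990`.  THEOREMS ONLY (no definition, no named fact, no instance, no notation, no `sorry`).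
Cell `pub/hodgecm-mathlib`, ENGINE T1 (crux H413 = `stmt-HodgeConjecture-24833`); floor-1½ preparation, count-neutral, under row (S-c) ∕ `stub_ScCore` of the «SdArch» pay-down line:
brick **(3G-c)** of F0P3a-p02 (g10)'s (R3-f) STEP 3 census — FILE G4b (G4a ★ `…CentralCurveRelabel` holds §1 and the `O(ψ²)` half); LEAD F0P3a-plan (g9) T8-73 (A); author F0P3a-p05 (g11).

WHAT IS PROVED (binders of ★ G4a; unitary `μ`): **`differentiableAt_archExplicitDelta_centralCurve_relabel_and_norm_deriv_le`** (`cos(c_{w₀}ψ₀) ≠ 1`),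
**`norm_deriv_archExplicitDelta_centralCurve_relabel_le`** (`∀ᶠ ψ in 𝓝[≠] 0, ‖∂Δ″_ρ(ψ)‖ ≤ (πG + 2)·K_D·c_{w₀}²·|ψ|`), **`hasDerivAt_archExplicitDelta_centralCurve_relabel_mul_zero`**
(`HasDerivAt (Δ″_ρ·F) 0 0`), **`tendsto_deriv_archExplicitDelta_centralCurve_relabel_mul`** (`∂(Δ″_ρ·F) → 0` on `𝓝[≠] 0` for `F` differentiable near `0`, `F, F′` bounded) — ★ G3 §2–§3 re-run
with `K_κ(ρ)` (★ G4a `norm_cast_prod_sign_mul_archMajoritySign_relabel_le_one`).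
HONEST LABEL: HC_CM is proved only modulo the printed citations until rung 0 closes; this file is calculus along a curve and pays nothing by itself.

## References
* [Rogawski1990] J. D. Rogawski, *Automorphic Representations of Unitary Groups in Three Variables*, Ann. of Math. Stud. 123 (1990): §14.5 Lemma 14.5.2 (c), p. 238; §14.6 p. 242; §4.9 p. 55.
-/

set_option autoImplicit false

noncomputable section

open NumberField NumberField.InfinitePlace Matrix Polynomial Filter Topology Complex Equiv
open scoped MatrixGroups Real

namespace Literature.NumberTheory.Rogawski1990

open Literature.NumberTheory.Automorphic
open Literature.NumberTheory.GaloisRepresentations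

/-! ## §0 Scalar helpers (private) -/

/-- `2 − 2cos x ≤ x²`. [folklore] -/
private theorem two_sub_two_mul_cos_le_sq₃ (x : ℝ) : 2 - 2 * Real.cos x ≤ x ^ 2 := by
  have h := Real.one_sub_sq_div_two_le_cos (x := x)
  linarith

/-- `0 ≤ 2 − 2cos x`. [folklore] -/
private theorem two_sub_two_mul_cos_nonneg₃ (x : ℝ) : 0 ≤ 2 - 2 * Real.cos x := by
  have h := Real.cos_le_one x
  linarith

/-- `|sin x| ≤ |x|`. [folklore] -/
private theorem abs_sin_le_abs₃ (x : ℝ) : |Real.sin x| ≤ |x| := by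
  simpa using Real.abs_sin_sub_sin_le x 0

/-- For `c ≠ 0`, `ψ ≠ 0` and `|c ψ| ≤ π∕2`: `cos(c ψ) ≠ 1`. [folklore] -/
private theorem cos_ne_one_of_abs_le₃ {c₀ ψ : ℝ} (hc₀ : c₀ ≠ 0) (hψ : ψ ≠ 0) (h : |c₀ * ψ| ≤ π / 2) : Real.cos (c₀ * ψ) ≠ 1 := by
  intro h1
  rw [Real.cos_eq_one_iff] at h1
  obtain ⟨n, hn⟩ := h1
  have hx0 : c₀ * ψ ≠ 0 := mul_ne_zero hc₀ hψ
  have hn0 : n ≠ 0 := by rintro rfl; apply hx0; rw [← hn]; simp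
  have h1 : (1 : ℝ) ≤ |(n : ℝ)| := by exact_mod_cast Int.one_le_abs hn0
  have habs : |c₀ * ψ| = |(n : ℝ)| * (2 * π) := by rw [← hn, abs_mul, abs_of_pos (by positivity : (0 : ℝ) < 2 * π)]
  nlinarith [Real.pi_pos, habs, h]

section Curve

variable (L : Type) [Field L] [NumberField L] [IsCMField L] (α : Fin 3 → L)
  (z₀ : {w : InfinitePlace L // IsComplex w} → Fin 3 → Circle) (c : {w : InfinitePlace L // IsComplex w} → ℝ)
  (γH : ℝ →
    ↥(UnitaryGroup.arch (↥(maximalRealSubfield L)) L (IsCMField.complexConj L) 2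
        (Matrix.of fun i j : Fin 2 => if i.val + j.val + 1 = 2 then (1 : L) else 0)) ×
      ↥(UnitaryGroup.arch (↥(maximalRealSubfield L)) L (IsCMField.complexConj L) 1
        (Matrix.of fun i j : Fin 1 => if i.val + j.val + 1 = 1 then (1 : L) else 0)))
  (γG : ℝ → ↥(UnitaryGroup.arch (↥(maximalRealSubfield L)) L (IsCMField.complexConj L) 3 (Matrix.diagonal α)))
  (hγH : γH = fun ψ =>
    ((UnitaryGroup.archPiEquivCM 2 L (Matrix.of fun i j : Fin 2 => if i.val + j.val + 1 = 2 then (1 : L) else 0)).symm fun w =>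
        ⟨Matrix.GeneralLinearGroup.mkOfDetNeZero !![(1 : ℂ), 1; 1, -1] UnitaryGroup.det_cayleyTwo_ne_zero *
            UnitaryGroup.circleDiagonal 2 ![z₀ w 0 * Circle.exp (![(1 : ℝ), 0, -1] 0 * (c w * ψ)), z₀ w 2 * Circle.exp (![(1 : ℝ), 0, -1] 2 * (c w * ψ))] *
          (Matrix.GeneralLinearGroup.mkOfDetNeZero !![(1 : ℂ), 1; 1, -1] UnitaryGroup.det_cayleyTwo_ne_zero)⁻¹,
          UnitaryGroup.cayley_conj_circleDiagonal_mem_archLocal L w _⟩,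
      (UnitaryGroup.archPiEquivCM 1 L (Matrix.of fun i j : Fin 1 => if i.val + j.val + 1 = 1 then (1 : L) else 0)).symm fun w =>
        ⟨UnitaryGroup.circleDiagonal 1 ![z₀ w 1 * Circle.exp (![(1 : ℝ), 0, -1] 1 * (c w * ψ))],
          UnitaryGroup.circleDiagonal_mem_archLocal_antidiagOne L w _⟩))
  (hγG : γG = fun ψ => UnitaryGroup.archDiagTorus L 3 α fun w i => z₀ w i * Circle.exp (![(1 : ℝ), 0, -1] i * (c w * ψ)))

  (ρ : {w : InfinitePlace L // IsComplex w} → Perm (Fin 3))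
  (γGρ : ℝ → ↥(UnitaryGroup.arch (↥(maximalRealSubfield L)) L (IsCMField.complexConj L) 3 (Matrix.diagonal α)))
  (hγGρ : γGρ = fun ψ => UnitaryGroup.archDiagTorus L 3 α fun w => (fun i => z₀ w i * Circle.exp (![(1 : ℝ), 0, -1] i * (c w * ψ))) ∘ ρ w)
  (w₀ : {w : InfinitePlace L // IsComplex w}) (μ : HeckeCharacter L)

/-! ## §1 The `ψ`-derivative of `Δ″_ρ` near the centre -/

include hγH hγG hγGρ in
open scoped Classical in
/-- **`Δ″_ρ` is differentiable at every `ψ₀` with `cos(c_{w₀}ψ₀) ≠ 1`, with `‖∂_ψ Δ″_ρ(ψ₀)‖ ≤ ‖τ′(ψ₀)‖·K_D(2 − 2cos cψ₀) + K_D|2c sin cψ₀|`.** [cite: Rogawski1990, §14.5 p. 238] -/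
theorem differentiableAt_archExplicitDelta_centralCurve_relabel_and_norm_deriv_le (hμu : μ.IsUnitary) (hc : ∀ w, w ≠ w₀ → c w = 0)
    (hcen : z₀ w₀ 0 = z₀ w₀ 1 ∧ z₀ w₀ 2 = z₀ w₀ 1) (hreg : ∀ w, w ≠ w₀ → z₀ w 1 ≠ z₀ w 0 ∧ z₀ w 1 ≠ z₀ w 2) {ψ₀ : ℝ} (hψ₀ : Real.cos (c w₀ * ψ₀) ≠ 1) :
    DifferentiableAt ℝ (fun ψ => archExplicitDelta L (Matrix.diagonal α) (γH ψ) μ (γGρ ψ)) ψ₀ ∧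
      ‖deriv (fun ψ => archExplicitDelta L (Matrix.diagonal α) (γH ψ) μ (γGρ ψ)) ψ₀‖ ≤
        ‖deriv (fun ψ => archTau L (γH ψ) μ) ψ₀‖ * ((∏ w ∈ Finset.univ.erase w₀, ‖((z₀ w 1 : ℂ) - z₀ w 0) * ((z₀ w 1 : ℂ) - z₀ w 2)‖) * (2 - 2 * Real.cos (c w₀ * ψ₀))) + (∏ w ∈ Finset.univ.erase w₀, ‖((z₀ w 1 : ℂ) - z₀ w 0) * ((z₀ w 1 : ℂ) - z₀ w 2)‖) * |2 * c w₀ * Real.sin (c w₀ * ψ₀)| := by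
  set K : ℝ := (∏ w ∈ Finset.univ.erase w₀, ‖((z₀ w 1 : ℂ) - z₀ w 0) * ((z₀ w 1 : ℂ) - z₀ w 2)‖) with hKdef
  set Kκ : ℤ := (∏ w : {w : InfinitePlace L // IsComplex w}, ((SignType.sign ((w.1.embedding (α ((ρ w).symm 1))).re) : ℤ) * archMajoritySign L (Matrix.diagonal α) w)) with hKκ
  have hK : 0 ≤ K := Finset.prod_nonneg fun _ _ => norm_nonneg _
  have hKκn : ‖((Kκ : ℤ) : ℂ)‖ ≤ 1 := norm_cast_prod_sign_mul_archMajoritySign_relabel_le_one L α ρ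
  set h : ℝ → ℂ := fun ψ => (((K * (2 - 2 * Real.cos (c w₀ * ψ))) : ℝ) : ℂ) * ((Kκ : ℤ) : ℂ) with hh
  have hhr : HasDerivAt (fun ψ : ℝ => K * (2 - 2 * Real.cos (c w₀ * ψ))) (K * (2 * c w₀ * Real.sin (c w₀ * ψ₀))) ψ₀ := by
    have h1 := (((Real.hasDerivAt_cos (c w₀ * ψ₀)).comp ψ₀ ((hasDerivAt_id ψ₀).const_mul (c w₀))).const_mul 2).const_sub 2
    have he : -((2 : ℝ) * (-Real.sin (c w₀ * ψ₀) * (c w₀ * 1))) = 2 * c w₀ * Real.sin (c w₀ * ψ₀) := by ring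
    rw [he] at h1
    exact h1.const_mul K
  have hhd : HasDerivAt h ((((K * (2 * c w₀ * Real.sin (c w₀ * ψ₀))) : ℝ) : ℂ) * ((Kκ : ℤ) : ℂ)) ψ₀ := by
    rw [hh]
    exact (HasDerivAt.ofReal_comp hhr).mul_const _
  have hτd := (differentiableAt_archTau_centralCurve L z₀ c γH hγH w₀ μ hμu hc hcen hreg hψ₀).hasDerivAt
  have hEq : (fun ψ => archExplicitDelta L (Matrix.diagonal α) (γH ψ) μ (γGρ ψ)) =ᶠ[𝓝 ψ₀] fun ψ => archTau L (γH ψ) μ * h ψ := by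
    filter_upwards [((Real.continuous_cos.comp (continuous_const.mul continuous_id)).continuousAt (x := ψ₀)).eventually_ne hψ₀] with ψ hψ
    have hψ' : Real.cos (c w₀ * ψ) ≠ 1 := hψ
    rw [archExplicitDelta_centralCurve_relabel_eq L α z₀ c γH γG hγH hγG ρ γGρ hγGρ w₀ μ hc hcen hreg hψ', hh, mul_assoc]
  have hprod := (hτd.mul hhd).congr_of_eventuallyEq hEq
  refine ⟨hprod.differentiableAt, ?_⟩
  rw [hprod.deriv]
  have hτn : ‖archTau L (γH ψ₀) μ‖ = 1 := norm_archTau_centralCurve_eq_one L z₀ c γH hγH w₀ μ hμu hc hcen hreg hψ₀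
  have hhn : ‖h ψ₀‖ ≤ K * (2 - 2 * Real.cos (c w₀ * ψ₀)) := by
    rw [hh]; dsimp only
    rw [norm_mul, Complex.norm_real, Real.norm_of_nonneg (mul_nonneg hK (two_sub_two_mul_cos_nonneg₃ _))]
    exact mul_le_of_le_one_right (mul_nonneg hK (two_sub_two_mul_cos_nonneg₃ _)) hKκn
  have hh'n : ‖(((K * (2 * c w₀ * Real.sin (c w₀ * ψ₀))) : ℝ) : ℂ) * ((Kκ : ℤ) : ℂ)‖ ≤ K * |2 * c w₀ * Real.sin (c w₀ * ψ₀)| := by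
    rw [norm_mul, Complex.norm_real, Real.norm_eq_abs, abs_mul, abs_of_nonneg hK]
    exact mul_le_of_le_one_right (mul_nonneg hK (abs_nonneg _)) hKκn
  refine (norm_add_le _ _).trans (add_le_add ?_ ?_)
  · exact (norm_mul_le _ _).trans (mul_le_mul_of_nonneg_left hhn (norm_nonneg _))
  · refine (norm_mul_le _ _).trans ?_
    rw [hτn, one_mul]
    exact hh'n

include hγH hγG hγGρ in
open scoped Classical in
/-- **`∀ᶠ ψ in 𝓝[≠] 0, ‖∂_ψ Δ″_ρ(ψ)‖ ≤ (π·G + 2) · K_D · c_{w₀}² · |ψ|`** (`G = ‖g′_{w₀}(1)‖`). [cite: Rogawski1990, §14.5 Lemma 14.5.2 (c), p. 238] -/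
theorem norm_deriv_archExplicitDelta_centralCurve_relabel_le (hμu : μ.IsUnitary) (hc₀ : c w₀ ≠ 0) (hc : ∀ w, w ≠ w₀ → c w = 0)
    (hcen : z₀ w₀ 0 = z₀ w₀ 1 ∧ z₀ w₀ 2 = z₀ w₀ 1) (hreg : ∀ w, w ≠ w₀ → z₀ w 1 ≠ z₀ w 0 ∧ z₀ w 1 ≠ z₀ w 2) :
    ∀ᶠ ψ in 𝓝[≠] (0 : ℝ), ‖deriv (fun ψ => archExplicitDelta L (Matrix.diagonal α) (γH ψ) μ (γGρ ψ)) ψ‖ ≤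
      (Real.pi * ‖deriv (fun r : ℝ => archHeckeValue L μ (((fun _ => 1, Pi.mulSingle w₀ ((r : ℂ))) : mixedEmbedding.mixedSpace L))) 1‖ + 2) * (∏ w ∈ Finset.univ.erase w₀, ‖((z₀ w 1 : ℂ) - z₀ w 0) * ((z₀ w 1 : ℂ) - z₀ w 2)‖) * (c w₀) ^ 2 * |ψ| := by
  have hsmall : ∀ᶠ ψ in 𝓝 (0 : ℝ), |c w₀ * ψ| ≤ π / 2 := by
    have hcont : ContinuousAt (fun ψ : ℝ => |c w₀ * ψ|) 0 := (continuous_abs.comp (continuous_const.mul continuous_id)).continuousAt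
    have h0 : |c w₀ * (0 : ℝ)| < π / 2 := by rw [mul_zero, abs_zero]; positivity
    exact (hcont.eventually (gt_mem_nhds h0)).mono fun ψ hψ => hψ.le
  filter_upwards [norm_deriv_archTau_centralCurve_le L z₀ c γH hγH w₀ μ hμu hc₀ hc hcen hreg, mem_nhdsWithin_of_mem_nhds hsmall, self_mem_nhdsWithin]
    with ψ hτ' hψs hψ0
  rw [Set.mem_compl_iff, Set.mem_singleton_iff] at hψ0
  have hcos : Real.cos (c w₀ * ψ) ≠ 1 := cos_ne_one_of_abs_le₃ hc₀ hψ0 hψs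
  set K : ℝ := (∏ w ∈ Finset.univ.erase w₀, ‖((z₀ w 1 : ℂ) - z₀ w 0) * ((z₀ w 1 : ℂ) - z₀ w 2)‖) with hKdef
  set G : ℝ := ‖deriv (fun r : ℝ => archHeckeValue L μ (((fun _ => 1, Pi.mulSingle w₀ ((r : ℂ))) : mixedEmbedding.mixedSpace L))) 1‖ with hGdef
  have hK : 0 ≤ K := Finset.prod_nonneg fun _ _ => norm_nonneg _
  have hG : 0 ≤ G := norm_nonneg _
  have hψpos : 0 < |ψ| := abs_pos.mpr hψ0
  have hb := (differentiableAt_archExplicitDelta_centralCurve_relabel_and_norm_deriv_le L α z₀ c γH γG hγH hγG ρ γGρ hγGρ w₀ μ hμu hc hcen hreg hcos).2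
  refine hb.trans ?_
  have h1 : ‖deriv (fun ψ => archTau L (γH ψ) μ) ψ‖ * (K * (2 - 2 * Real.cos (c w₀ * ψ))) ≤ Real.pi * G / |ψ| * (K * ((c w₀ * ψ) ^ 2)) :=
    mul_le_mul hτ' (mul_le_mul_of_nonneg_left (two_sub_two_mul_cos_le_sq₃ _) hK) (mul_nonneg hK (two_sub_two_mul_cos_nonneg₃ _)) (by positivity)
  have h2 : K * |2 * c w₀ * Real.sin (c w₀ * ψ)| ≤ K * (2 * |c w₀| * |c w₀ * ψ|) := by
    refine mul_le_mul_of_nonneg_left ?_ hK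
    rw [abs_mul, abs_mul, abs_two]
    exact mul_le_mul_of_nonneg_left (abs_sin_le_abs₃ _) (by positivity)
  refine (add_le_add h1 h2).trans (le_of_eq ?_)
  rw [abs_mul, mul_pow]
  have hψ2 : ψ ^ 2 = |ψ| * |ψ| := by rw [← sq, sq_abs]
  have hc2 : (c w₀) ^ 2 = |c w₀| * |c w₀| := by rw [← sq, sq_abs]
  rw [hψ2, hc2]
  field_simp

include hγH hγG hγGρ in
/-- **`HasDerivAt (ψ ↦ Δ″_ρ(ψ) · F(ψ)) 0 0`** for any `F` differentiable at `0`. [cite: Rogawski1990, §14.5 Lemma 14.5.2 (c), p. 238] -/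
theorem hasDerivAt_archExplicitDelta_centralCurve_relabel_mul_zero (hμu : μ.IsUnitary) (hc : ∀ w, w ≠ w₀ → c w = 0)
    (hcen : z₀ w₀ 0 = z₀ w₀ 1 ∧ z₀ w₀ 2 = z₀ w₀ 1) (hreg : ∀ w, w ≠ w₀ → z₀ w 1 ≠ z₀ w 0 ∧ z₀ w 1 ≠ z₀ w 2) {F : ℝ → ℂ} (hF : DifferentiableAt ℝ F 0) :
    HasDerivAt (fun ψ => archExplicitDelta L (Matrix.diagonal α) (γH ψ) μ (γGρ ψ) * F ψ) 0 0 := by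
  have h := (hasDerivAt_archExplicitDelta_centralCurve_relabel_zero L α z₀ c γH γG hγH hγG ρ γGρ hγGρ w₀ μ hμu hc hcen hreg).mul hF.hasDerivAt
  rw [archExplicitDelta_centralCurve_relabel_zero L α z₀ c γH γG hγH hγG ρ γGρ hγGρ w₀ μ hμu hc hcen hreg, zero_mul, zero_mul, add_zero] at h
  exact h

include hγH hγG hγGρ in
/-- **`∂_ψ (Δ″_ρ · F)(ψ) → 0` on `𝓝[≠] 0`** for `F` differentiable near `0` with `F`, `F′` bounded there. [cite: Rogawski1990, §14.5 Lemma 14.5.2 (c), p. 238] -/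
theorem tendsto_deriv_archExplicitDelta_centralCurve_relabel_mul (hμu : μ.IsUnitary) (hc₀ : c w₀ ≠ 0) (hc : ∀ w, w ≠ w₀ → c w = 0)
    (hcen : z₀ w₀ 0 = z₀ w₀ 1 ∧ z₀ w₀ 2 = z₀ w₀ 1) (hreg : ∀ w, w ≠ w₀ → z₀ w 1 ≠ z₀ w 0 ∧ z₀ w 1 ≠ z₀ w 2) {F : ℝ → ℂ} {M : ℝ}
    (hF : ∀ᶠ ψ in 𝓝 (0 : ℝ), DifferentiableAt ℝ F ψ) (hFb : ∀ᶠ ψ in 𝓝 (0 : ℝ), ‖F ψ‖ ≤ M) (hF'b : ∀ᶠ ψ in 𝓝 (0 : ℝ), ‖deriv F ψ‖ ≤ M) :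
    Tendsto (fun ψ => deriv (fun ψ => archExplicitDelta L (Matrix.diagonal α) (γH ψ) μ (γGρ ψ) * F ψ) ψ) (𝓝[≠] 0) (𝓝 0) := by
  classical
  have hsmall : ∀ᶠ ψ in 𝓝 (0 : ℝ), |c w₀ * ψ| ≤ π / 2 := by
    have hcont : ContinuousAt (fun ψ : ℝ => |c w₀ * ψ|) 0 := (continuous_abs.comp (continuous_const.mul continuous_id)).continuousAt
    have h0 : |c w₀ * (0 : ℝ)| < π / 2 := by rw [mul_zero, abs_zero]; positivity
    exact (hcont.eventually (gt_mem_nhds h0)).mono fun ψ hψ => hψ.le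
  have hM : 0 ≤ M := by
    obtain ⟨ψ, hψ⟩ := hFb.exists
    exact (norm_nonneg _).trans hψ
  have hbound : ∀ᶠ ψ in 𝓝[≠] (0 : ℝ), ‖deriv (fun ψ => archExplicitDelta L (Matrix.diagonal α) (γH ψ) μ (γGρ ψ) * F ψ) ψ‖ ≤
      ((Real.pi * ‖deriv (fun r : ℝ => archHeckeValue L μ (((fun _ => 1, Pi.mulSingle w₀ ((r : ℂ))) : mixedEmbedding.mixedSpace L))) 1‖ + 2) * (∏ w ∈ Finset.univ.erase w₀, ‖((z₀ w 1 : ℂ) - z₀ w 0) * ((z₀ w 1 : ℂ) - z₀ w 2)‖) * (c w₀) ^ 2 * |ψ|) * M + ((∏ w ∈ Finset.univ.erase w₀, ‖((z₀ w 1 : ℂ) - z₀ w 0) * ((z₀ w 1 : ℂ) - z₀ w 2)‖) * (c w₀) ^ 2 * ψ ^ 2) * M := by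
    filter_upwards [norm_deriv_archExplicitDelta_centralCurve_relabel_le L α z₀ c γH γG hγH hγG ρ γGρ hγGρ w₀ μ hμu hc₀ hc hcen hreg,
      mem_nhdsWithin_of_mem_nhds hsmall, mem_nhdsWithin_of_mem_nhds hF, mem_nhdsWithin_of_mem_nhds hFb, mem_nhdsWithin_of_mem_nhds hF'b, self_mem_nhdsWithin]
      with ψ hD' hψs hFψ hFbψ hF'bψ hψ0
    rw [Set.mem_compl_iff, Set.mem_singleton_iff] at hψ0
    have hcos : Real.cos (c w₀ * ψ) ≠ 1 := cos_ne_one_of_abs_le₃ hc₀ hψ0 hψs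
    have hΔ := (differentiableAt_archExplicitDelta_centralCurve_relabel_and_norm_deriv_le L α z₀ c γH γG hγH hγG ρ γGρ hγGρ w₀ μ hμu hc hcen hreg hcos).1
    have hmul : HasDerivAt (fun ψ => archExplicitDelta L (Matrix.diagonal α) (γH ψ) μ (γGρ ψ) * F ψ)
        (deriv (fun ψ => archExplicitDelta L (Matrix.diagonal α) (γH ψ) μ (γGρ ψ)) ψ * F ψ +
          archExplicitDelta L (Matrix.diagonal α) (γH ψ) μ (γGρ ψ) * deriv F ψ) ψ := hΔ.hasDerivAt.mul hFψ.hasDerivAt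
    rw [hmul.deriv]
    refine (norm_add_le _ _).trans (add_le_add ?_ ?_)
    · exact (norm_mul_le _ _).trans (mul_le_mul hD' hFbψ (norm_nonneg _) (by positivity))
    · exact (norm_mul_le _ _).trans (mul_le_mul (norm_archExplicitDelta_centralCurve_relabel_le_sq L α z₀ c γH γG hγH hγG ρ γGρ hγGρ w₀ μ hμu hc hcen hreg ψ) hF'bψ
        (norm_nonneg _) (by positivity))
  refine squeeze_zero_norm' hbound ?_
  have h : Tendsto (fun ψ : ℝ => ((Real.pi * ‖deriv (fun r : ℝ => archHeckeValue L μ (((fun _ => 1, Pi.mulSingle w₀ ((r : ℂ))) : mixedEmbedding.mixedSpace L))) 1‖ + 2) * (∏ w ∈ Finset.univ.erase w₀, ‖((z₀ w 1 : ℂ) - z₀ w 0) * ((z₀ w 1 : ℂ) - z₀ w 2)‖) * (c w₀) ^ 2 * |ψ|) * M + ((∏ w ∈ Finset.univ.erase w₀, ‖((z₀ w 1 : ℂ) - z₀ w 0) * ((z₀ w 1 : ℂ) - z₀ w 2)‖) * (c w₀) ^ 2 * ψ ^ 2) * M) (𝓝 0)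
      (𝓝 (((Real.pi * ‖deriv (fun r : ℝ => archHeckeValue L μ (((fun _ => 1, Pi.mulSingle w₀ ((r : ℂ))) : mixedEmbedding.mixedSpace L))) 1‖ + 2) * (∏ w ∈ Finset.univ.erase w₀, ‖((z₀ w 1 : ℂ) - z₀ w 0) * ((z₀ w 1 : ℂ) - z₀ w 2)‖) * (c w₀) ^ 2 * |(0 : ℝ)|) * M + ((∏ w ∈ Finset.univ.erase w₀, ‖((z₀ w 1 : ℂ) - z₀ w 0) * ((z₀ w 1 : ℂ) - z₀ w 2)‖) * (c w₀) ^ 2 * (0 : ℝ) ^ 2) * M)) :=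
    (((continuous_const.mul continuous_abs).mul continuous_const).add ((continuous_const.mul (continuous_pow 2)).mul continuous_const)).tendsto 0
  simp only [abs_zero, mul_zero, zero_mul, zero_add, ne_eq, OfNat.ofNat_ne_zero, not_false_eq_true, zero_pow] at h
  exact h.mono_left nhdsWithin_le_nhds

end Curve

end Literature.NumberTheory.Rogawski1990

end
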